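/-
Copyright (c) 2026 the pub-hodgecm-mathlib formalisation cell (harness21).  Prover seat hodgecm-mathlib-A-p19 (g20), topic T5 = P8
«(C♯)hol interior», node C∞ ([Liu2021, Lem. D.2 (2)] at the place of `ι`), FILE 1 of the road «K-type of `(1,0)`-forms»
(census 2026-08-31T23:10Z, desk F0P2-plan (g8) ∕ lead B-p18 (g29)).  KERNEL module: THEOREMS ONLY (no definition, no named fact,
no `sorry`, no instance, no notation).
-/
import Literature.NumberTheory.Automorphic.Liu2021.ThetaLiftFromLineFrameArchSingle
import Literature.NumberTheory.Automorphic.Liu2021.ThetaLiftFromLineTotality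
import HarnessLib

/-!
# The projected theta functional is `U(H)(𝔸)`-EQUIVARIANT, CYCLIC in an irreducible `P`, and the cotangent classes carry the
# `K_∞`-type `k₀ ↦ Jac k₀ x₀` ([Liu2021, proof of Prop. 4.13 Case 1]; [BorelJacquet1979, §4.6]; [Borel1997, §5.14])

Topic `NumberTheory/Automorphic/Liu2021`; namespace `Literature.NumberTheory.Automorphic.Liu2021`.  KERNEL: theorems only.  Cell
hodgecm-mathlib FLOOR 0, programme P2, topic T5 = P8 «(C♯)hol interior», node **C∞** = [Liu2021, Lem. D.2 (2)] applied at the place of `ι`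
(★ `Liu2021.meetsThetaLiftFromLine_hol_archTypeAt`, p826262): FILE 1 of the road «the `K_∞ = U(2) × U(1)`-type of holomorphic `(1,0)`-forms occurs
in `ω_χ|_{U(2,1)}` only in the `m = −1` holomorphic ladder».  Node Cc (★ `F0P2oCcArchTypeAwayHolds`) killed the theta functional
`Ψ ↦ pr_P [Θ̃_Ψ(f) ∘ ιA]` by INVARIANCE under the compact `U(V_w)` (`w ≠ w(ι)`); at `w(ι)` the group `U(V_w) ≅ U(2,1)` is not compact and
`P` is not fixed, so node C∞ needs the three generic statements of this file instead:

* §1 **EQUIVARIANCE under all of `U(H)(𝔸_{L⁺})`** — `pr_P [Θ̃_{ω(ιA k, 1)Ψ}(f) ∘ ιA] = R(k) (pr_P [Θ̃_Ψ(f) ∘ ιA])` (★ `rightRegular_toLp_lineThetaLift`: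
  `R(k) [Θ̃_Ψ ∘ ιA] = [Θ̃_{ω(ιA k,1)Ψ} ∘ ιA]`; ★ `DiscreteAutomorphicRep.starProjection_rightRegular`: `pr_P ∘ R(k) = R(k) ∘ pr_P`), and its
  ONE-PLACE form at ANY complex place `w₀` (★ `exists_arch_cmAdelicFrameTransport_archToAdelic_eq_adelicSingle`: `adelicSingle w₀ u = ιA (a, 1_f)`
  with `a_w = 1` off `w₀`): `pr_P [Θ̃_{ω((u at w₀), 1)Ψ}(f) ∘ ιA] = R((a, 1_f)) (pr_P [Θ̃_Ψ(f) ∘ ιA])`;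
* §2 **CYCLICITY** — if ONE projected theta class is non-zero, then for EVERY non-zero `v ∈ P` some PURE TENSOR `E(φ ⊗ Φ_f)` has
  `⟪v, pr_P [Θ̃_{E(φ ⊗ Φ_f)}(f) ∘ ιA]⟫ ≠ 0`: the closed span of the projected theta classes is a closed `U(H)(𝔸)`-stable (§1) non-zero
  subspace of the IRREDUCIBLE `P` (★ `DiscreteAutomorphicRep.irreducible`, read as in ★ `ClosedSubrep.fixedVectors_eq_top_of_isTopIrreducible`),
  hence all of `P`; a vector orthogonal to every projected class is orthogonal to that closed span, so to itself; and a non-zero value on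
  some class is a non-zero value on a pure tensor (★ `exists_tmul_apply_toLp_lineThetaLift_ne_zero`, [Tate1967, §3.2]);
* §3 **THE `K_∞`-TYPE OF THE COTANGENT CLASSES** — for a holomorphic cotangent form `Φ` of the (C♯)hol frame (★ `holCotForms … (cmArchSection …)
  (cmCompactFactor …)`; right `K_∞`-type the cotangent isotropy representation ★ `BallForms.cotangentCocycle`, [Borel1997, §5.14]: `Φ(x σ(k₀)) =
  (Jac k₀ x₀)ᵀ Φ(x)` for `k₀ ∈ Stab_{U(2,1)}(x₀)`, ★ `WeightForms.right_equiv`) whose coordinate classes are square-integrable: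
  `R(σ(k₀)) [Φ_j] = Σ_i (Jac k₀ x₀)_{i j} • [Φ_i]` (`σ = cmArchSection`; `R(z)[F]([x]) = [F]([z⁻¹ x])`, Mathlib `DomMulAct.mk_smul_toLp`, and
  `[x] ↦ Φ_j(x⁻¹ σ(k₀))`, ★ `toQuotFun_mk` — the B4 pattern of ★ `rightRegular_archCentre_toLp_toQuotFun` with a non-scalar `k₀`); and the
  TRANSLATED form: for `h ∈ U(2,1)` the classes `w_j = R(σ(h)) [Φ_j]` satisfy `R(σ(h k₀ h⁻¹)) w_j = Σ_i (Jac k₀ x₀)_{i j} • w_i` — the span of the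
  two classes is the `K_∞`-module `k₀ = diag(A, d) ↦ Jac k₀ x₀ = d⁻¹ A` (★ `U21KTypes.pPlus`, [BorelWallach2000, VI 4.7]; [Holzapfel1998, §4.1]),
  transported to the stabiliser `h Stab(x₀) h⁻¹ = Stab(h x₀)` of any other point of the ball (★ `isPretransitive_U21_ball`).

HONEST SCOPE.  Nothing of [Liu2021] is asserted and nothing archimedean is computed here; these are the representation-theoretic inputs of
node C∞'s closer (with the sign-block phase of Folland's section at the indefinite place, the frame alignment `ιA⁻¹(u at w(ι)) ∈ σ(Stab(x₁)) · K_c`,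
and the Fock-space irreducibility on the positive `2`-block — separate files).  HC_CM is proved only modulo the printed citations until rung 0
closes; this file books nothing and discharges nothing booked.

## References
* [Liu2021] Y. Liu, Camb. J. Math. 9 (2021) = arXiv:2102.11518, proof of Prop. 4.13 Case 1 (l. 2137–2141, p. 48); App. D Lem. D.2 (2) (l. 5285).
* [BorelJacquet1979] A. Borel, H. Jacquet, PSPM 33.1 (1979), §4.1 (`G(𝔸) = G_∞ × G(𝔸_f)`), §4.6 (irreducible constituents of `L²`).
* [Borel1997] A. Borel, *Automorphic forms on SL₂(ℝ)*, Cambridge Tracts 130 (1997), §5.14 (forms of `K`-type `τ` read on the group).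
* [BorelWallach2000] A. Borel, N. Wallach (2000), VI 4.7 (`K = U(2) × U(1)`, the isotropy representation on `𝔭₊`).
* [Holzapfel1998] R.-P. Holzapfel, *Ball and Surface Arithmetics* (1998), §4.1 (`k · [z:1] = [d⁻¹ A z : 1]`).
* [DeitmarEchterhoff2014] A. Deitmar, S. Echterhoff, *Principles of Harmonic Analysis*, 2nd ed., Thm. 7.3.2 (closed invariant subspaces).
* [Tate1967] J. Tate, *Fourier analysis in number fields*, §3.2 (Schwartz–Bruhat functions are finite sums of pure tensors).
-/

set_option autoImplicit false

noncomputable section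

open NumberField MeasureTheory IsDedekindDomain MulAction
open scoped Matrix ComplexOrder ENNReal TensorProduct SchwartzMap InnerProductSpace Classical

namespace Literature.NumberTheory.Automorphic.Liu2021

open _root_.MeasureTheory
open Literature.NumberTheory.Automorphic Literature.NumberTheory.Automorphic.UnitaryGroup
open Literature.NumberTheory.Automorphic.UnitaryGroup.CotangentForms
open Literature.NumberTheory.Automorphic.IdeleClassGroup
open Literature.NumberTheory.Automorphic.Liu2021.Def411WeilCarriers
open Literature.NumberTheory.Automorphic.Liu2021.Def411WeilCarriersDoubling
open Literature.NumberTheory.GelbartRogawski1991 Literature.NumberTheory.GelbartRogawski1991.UnitaryDualPair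
open Literature.NumberTheory.Weil1964
open Literature.RepresentationTheory.Liu2021
open Literature.AlgebraicGeometry.ShimuraVarieties Literature.Geometry.ComplexHyperbolic Literature.Geometry.ComplexHyperbolic.BallModel
open Literature.NumberTheory.Automorphic.AutomorphyFactor

/-! ## §1 Equivariance of the projected theta classes under all of `U(H)(𝔸_{L⁺})` -/

section Equivariance

variable (L : Type) [Field L] [NumberField L] [IsCMField L] {N : ℕ} (H : Matrix (Fin N) (Fin N) L)
  {n' : ℕ} (e₁ : Fin N × Fin 1 ≃ Fin n') (dV : Fin N → L) (hdV : ∀ i, IsCMField.complexConj L (dV i) = dV i)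
  (hdV0 : ∀ i, dV i ≠ 0) (g : GL (Fin N) L)
  (hg : ((g : Matrix (Fin N) (Fin N) L).map (cmConjRingHom L))ᵀ * H * (g : Matrix (Fin N) (Fin N) L) = Matrix.diagonal dV)
  (μ : Literature.NumberTheory.Automorphic.IdeleClassGroup L →ₜ* Circle) (hμ : IsConjugateSymplectic L μ) (a : (↥(maximalRealSubfield L))ˣ)
  (hρ : HasThetaMajorants fun
      (p : ↥(UnitaryGroup.adelic (↥(maximalRealSubfield L)) L (IsCMField.complexConj L) N (Matrix.diagonal dV)) × ↥(UnitaryGroup.adelic (↥(maximalRealSubfield L)) L (IsCMField.complexConj L) 1 (JW (↥(maximalRealSubfield L)) L a))) (Φ : piSchwartzBruhat (↥(maximalRealSubfield L)) (Fin n')) =>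
        pairRep (↥(maximalRealSubfield L)) L (IsCMField.complexConj L) N 1 e₁ (Matrix.diagonal dV) (JW (↥(maximalRealSubfield L)) L a)
          (chiSplittingLine L e₁ dV hdV hdV0 (toHeckeCharacter L μ) (isUnitary_toHeckeCharacter L μ)
            ((isOscillatorChar_toHeckeCharacter_iff μ).mpr hμ) (TW (↥(maximalRealSubfield L)) a)
            (isUnit_det_TW (↥(maximalRealSubfield L)) a) (JW (↥(maximalRealSubfield L)) L a) (JW_eq (↥(maximalRealSubfield L)) L a))
          p Φ)
  [CompactSpace (↥(UnitaryGroup.adelic (↥(maximalRealSubfield L)) L (IsCMField.complexConj L) N (Matrix.diagonal dV)) ⧸ (UnitaryGroup.toAdelic (↥(maximalRealSubfield L)) L (IsCMField.complexConj L) N (Matrix.diagonal dV)).range)] [MeasurableSpace (↥(UnitaryGroup.adelic (↥(maximalRealSubfield L)) L (IsCMField.complexConj L) 1 (JW (↥(maximalRealSubfield L)) L a)) ⧸ (UnitaryGroup.toAdelic (↥(maximalRealSubfield L)) L (IsCMField.complexConj L) 1 (JW (↥(maximalRealSubfield L)) L a)).range)] [BorelSpace (↥(UnitaryGroup.adelic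 (↥(maximalRealSubfield L)) L (IsCMField.complexConj L) 1 (JW (↥(maximalRealSubfield L)) L a)) ⧸ (UnitaryGroup.toAdelic (↥(maximalRealSubfield L)) L (IsCMField.complexConj L) 1 (JW (↥(maximalRealSubfield L)) L a)).range)] (μW : Measure (↥(UnitaryGroup.adelic (↥(maximalRealSubfield L)) L (IsCMField.complexConj L) 1 (JW (↥(maximalRealSubfield L)) L a)) ⧸ (UnitaryGroup.toAdelic (↥(maximalRealSubfield L)) L (IsCMField.complexConj L) 1 (JW (↥(maximalRealSubfield L)) L a)).range)) [IsFiniteMeasure μW]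
  (Ψ : piSchwartzBruhat (↥(maximalRealSubfield L)) (Fin n'))
  (f : C((↥(UnitaryGroup.adelic (↥(maximalRealSubfield L)) L (IsCMField.complexConj L) 1 (JW (↥(maximalRealSubfield L)) L a)) ⧸ (UnitaryGroup.toAdelic (↥(maximalRealSubfield L)) L (IsCMField.complexConj L) 1 (JW (↥(maximalRealSubfield L)) L a)).range), ℂ))
  {μA : Measure (adelicGroupData (↥(maximalRealSubfield L)) L (IsCMField.complexConj L) N H).automorphicQuotient}
  [(adelicGroupData (↥(maximalRealSubfield L)) L (IsCMField.complexConj L) N H).IsAutomorphicMeasure μA]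
  [CompactSpace (adelicGroupData (↥(maximalRealSubfield L)) L (IsCMField.complexConj L) N H).automorphicQuotient]
  (P : DiscreteAutomorphicRep (adelicGroupData (↥(maximalRealSubfield L)) L (IsCMField.complexConj L) N H) μA)

/-- **THE PROJECTED THETA CLASSES ARE `U(H)(𝔸_{L⁺})`-EQUIVARIANT**: `pr_P [Θ̃_{ω(ιA k, 1)Ψ}(f) ∘ ιA] = R(k) (pr_P [Θ̃_Ψ(f) ∘ ιA])` for every
`k ∈ U(H)(𝔸_{L⁺})`, every Schwartz–Bruhat `Ψ` and every weight `f` (★ `rightRegular_toLp_lineThetaLift` + ★ `starProjection_rightRegular`) —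
the theta functional `Ψ ↦ pr_P [Θ̃_Ψ(f) ∘ ιA]` intertwines `ω|_{U(diag dV) × 1} ∘ ιA` with `P`.
[cite: BorelJacquet1979, §4.6] [cite: Liu2021, proof of Prop. 4.13 Case 1 (l. 2137–2141, p. 48)] -/
theorem starProjection_toLp_lineThetaLift_pairRep (k : (adelicGroupData (↥(maximalRealSubfield L)) L (IsCMField.complexConj L) N H).Adelic) :
    P.space.toSubmodule.starProjection
        (MemLp.toLp _ (memLp_toQuotFun_lineThetaLift L N H e₁ dV hdV hdV0 g hg μ hμ a hρ μW
          ((pairRep (↥(maximalRealSubfield L)) L (IsCMField.complexConj L) N 1 e₁ (Matrix.diagonal dV) (JW (↥(maximalRealSubfield L)) L a)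
            (chiSplittingLine L e₁ dV hdV hdV0 (toHeckeCharacter L μ) (isUnitary_toHeckeCharacter L μ)
              ((isOscillatorChar_toHeckeCharacter_iff μ).mpr hμ) (TW (↥(maximalRealSubfield L)) a)
              (isUnit_det_TW (↥(maximalRealSubfield L)) a) (JW (↥(maximalRealSubfield L)) L a) (JW_eq (↥(maximalRealSubfield L)) L a)))
            ((cmAdelicFrameTransport L N H dV g hg) k, 1) Ψ) f μA 2)) =
      (adelicGroupData (↥(maximalRealSubfield L)) L (IsCMField.complexConj L) N H).rightRegular μA k
        (P.space.toSubmodule.starProjection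
          (MemLp.toLp _ (memLp_toQuotFun_lineThetaLift L N H e₁ dV hdV hdV0 g hg μ hμ a hρ μW Ψ f μA 2))) := by
  rw [← rightRegular_toLp_lineThetaLift L N H e₁ dV hdV hdV0 g hg μ hμ a hρ μW Ψ f μA k,
    DiscreteAutomorphicRep.starProjection_rightRegular]

/-- **ONE-PLACE FORM at ANY complex place `w₀`** (also `w(ι)`): for `u ∈ U(σ_{w₀} diag dV)(ℂ)` there is an archimedean `a ∈ U(H)(L⁺ ⊗ ℝ)`,
trivial at every complex place `w ≠ w₀`, with `pr_P [Θ̃_{ω((u at w₀, 1 elsewhere), 1)Ψ}(f) ∘ ιA] = R((a, 1_f)) (pr_P [Θ̃_Ψ(f) ∘ ιA])`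
(§1 at `k = (a, 1_f)`, ★ `exists_arch_cmAdelicFrameTransport_archToAdelic_eq_adelicSingle`). [cite: BorelJacquet1979, §4.1, §4.6] -/
theorem exists_arch_starProjection_toLp_lineThetaLift_pairRep_adelicSingle (w₀ : {w : InfinitePlace L // w.IsComplex})
    (u : UnitaryGroup.archLocal L N (Matrix.diagonal dV) w₀) :
    ∃ b : UnitaryGroup.arch (↥(maximalRealSubfield L)) L (IsCMField.complexConj L) N H,
      (∀ w : {w : InfinitePlace L // w.IsComplex}, w ≠ w₀ →
        UnitaryGroup.archAt (↥(maximalRealSubfield L)) L (IsCMField.complexConj L) N H w (complexConj_smul_infinitePlace L w.1)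
          (IsCMField.complexConj_ne_one L) b = 1) ∧
      cmAdelicFrameTransport L N H dV g hg (UnitaryGroup.archToAdelic (↥(maximalRealSubfield L)) L (IsCMField.complexConj L) N H b) =
          UnitaryGroup.adelicSingle (↥(maximalRealSubfield L)) L (IsCMField.complexConj L) N (Matrix.diagonal dV) (IsCMField.complexConj_ne_one L)
            (complexConj_smul_infinitePlace L) w₀ u ∧
      P.space.toSubmodule.starProjection
          (MemLp.toLp _ (memLp_toQuotFun_lineThetaLift L N H e₁ dV hdV hdV0 g hg μ hμ a hρ μW
            ((pairRep (↥(maximalRealSubfield L)) L (IsCMField.complexConj L) N 1 e₁ (Matrix.diagonal dV) (JW (↥(maximalRealSubfield L)) L a)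
              (chiSplittingLine L e₁ dV hdV hdV0 (toHeckeCharacter L μ) (isUnitary_toHeckeCharacter L μ)
                ((isOscillatorChar_toHeckeCharacter_iff μ).mpr hμ) (TW (↥(maximalRealSubfield L)) a)
                (isUnit_det_TW (↥(maximalRealSubfield L)) a) (JW (↥(maximalRealSubfield L)) L a) (JW_eq (↥(maximalRealSubfield L)) L a)))
              (UnitaryGroup.adelicSingle (↥(maximalRealSubfield L)) L (IsCMField.complexConj L) N (Matrix.diagonal dV) (IsCMField.complexConj_ne_one L)
                (complexConj_smul_infinitePlace L) w₀ u, 1) Ψ) f μA 2)) =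
        (adelicGroupData (↥(maximalRealSubfield L)) L (IsCMField.complexConj L) N H).rightRegular μA
          (UnitaryGroup.archToAdelic (↥(maximalRealSubfield L)) L (IsCMField.complexConj L) N H b)
          (P.space.toSubmodule.starProjection
            (MemLp.toLp _ (memLp_toQuotFun_lineThetaLift L N H e₁ dV hdV hdV0 g hg μ hμ a hρ μW Ψ f μA 2))) := by
  obtain ⟨b, hb, hcomp⟩ := exists_arch_cmAdelicFrameTransport_archToAdelic_eq_adelicSingle L H dV g hg w₀ u
  refine ⟨b, hcomp, hb, ?_⟩
  rw [← hb]
  exact starProjection_toLp_lineThetaLift_pairRep L H e₁ dV hdV hdV0 g hg μ hμ a hρ μW Ψ f P _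

/-! ## §2 Cyclicity: one non-zero projected theta class makes every non-zero vector of `P` see a pure tensor -/

/-- **THE CLOSED SPAN OF THE PROJECTED THETA CLASSES IS ALL OF `P`** once one of them is non-zero: it is a closed, `U(H)(𝔸)`-stable (§1),
non-zero subspace of the irreducible `P`. [cite: BorelJacquet1979, §4.6] [cite: DeitmarEchterhoff2014, Thm. 7.3.2] -/
theorem le_topologicalClosure_span_starProjection_toLp_lineThetaLift (Ψ₀ : piSchwartzBruhat (↥(maximalRealSubfield L)) (Fin n'))
    (hΨ₀ : P.space.toSubmodule.starProjection
      (MemLp.toLp _ (memLp_toQuotFun_lineThetaLift L N H e₁ dV hdV hdV0 g hg μ hμ a hρ μW Ψ₀ f μA 2)) ≠ 0) :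
    P.space.toSubmodule ≤
      (Submodule.span ℂ (Set.range fun Ψ : piSchwartzBruhat (↥(maximalRealSubfield L)) (Fin n') =>
        P.space.toSubmodule.starProjection
          (MemLp.toLp _ (memLp_toQuotFun_lineThetaLift L N H e₁ dV hdV hdV0 g hg μ hμ a hρ μW Ψ f μA 2)))).topologicalClosure := by
  set S : Submodule ℂ ((adelicGroupData (↥(maximalRealSubfield L)) L (IsCMField.complexConj L) N H).L2 μA) :=
    Submodule.span ℂ (Set.range fun Ψ : piSchwartzBruhat (↥(maximalRealSubfield L)) (Fin n') =>
      P.space.toSubmodule.starProjection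
        (MemLp.toLp _ (memLp_toQuotFun_lineThetaLift L N H e₁ dV hdV hdV0 g hg μ hμ a hρ μW Ψ f μA 2))) with hS
  -- `S ≤ P`
  have hSP : S ≤ P.space.toSubmodule := by
    rw [hS, Submodule.span_le]
    rintro _ ⟨Ψ, rfl⟩
    exact P.space.toSubmodule.starProjection_apply_mem _
  -- `S` is `R(k)`-stable for every `k` (§1)
  have hstab : ∀ k : (adelicGroupData (↥(maximalRealSubfield L)) L (IsCMField.complexConj L) N H).Adelic,
      S ≤ S.comap (((adelicGroupData (↥(maximalRealSubfield L)) L (IsCMField.complexConj L) N H).rightRegular μA k :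
        (adelicGroupData (↥(maximalRealSubfield L)) L (IsCMField.complexConj L) N H).L2 μA →L[ℂ]
          (adelicGroupData (↥(maximalRealSubfield L)) L (IsCMField.complexConj L) N H).L2 μA) : _ →ₗ[ℂ] _) := by
    intro k
    rw [hS, Submodule.span_le]
    rintro _ ⟨Ψ, rfl⟩
    rw [SetLike.mem_coe, Submodule.mem_comap]
    exact Submodule.subset_span ⟨_, starProjection_toLp_lineThetaLift_pairRep L H e₁ dV hdV hdV0 g hg μ hμ a hρ μW Ψ f P k⟩
  -- its closure, pulled back to the subtype `P`, is a closed subrepresentation of `P`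
  have hmaps : ∀ k : (adelicGroupData (↥(maximalRealSubfield L)) L (IsCMField.complexConj L) N H).Adelic,
      Set.MapsTo ((adelicGroupData (↥(maximalRealSubfield L)) L (IsCMField.complexConj L) N H).rightRegular μA k)
        (S.topologicalClosure : Set _) (S.topologicalClosure : Set _) := by
    intro k
    have h1 : Set.MapsTo ((adelicGroupData (↥(maximalRealSubfield L)) L (IsCMField.complexConj L) N H).rightRegular μA k)
        (S : Set _) (S : Set _) := fun x hx => hstab k hx
    have h2 := h1.closure ((adelicGroupData (↥(maximalRealSubfield L)) L (IsCMField.complexConj L) N H).rightRegular μA k).continuous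
    rwa [← Submodule.topologicalClosure_coe] at h2
  let F : ContRepresentation.ClosedSubrep P.space.toContRep :=
    { toSubmodule := S.topologicalClosure.comap P.space.toSubmodule.subtype
      apply_mem_toSubmodule := fun k v hv => by
        rw [Submodule.mem_comap] at hv ⊢
        exact hmaps k hv
      isClosed' := (Submodule.isClosed_topologicalClosure S).preimage continuous_subtype_val }
  have hF : F = ⊥ ∨ F = ⊤ := ((ContRepresentation.isTopIrreducible_iff _).1 P.irreducible).2 F
  rcases hF with hF | hF
  · -- impossible: `F` contains the non-zero class `pr_P [Θ̃_{Ψ₀}]`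
    exfalso
    apply hΨ₀
    have hmem : (⟨_, P.space.toSubmodule.starProjection_apply_mem
        (MemLp.toLp _ (memLp_toQuotFun_lineThetaLift L N H e₁ dV hdV hdV0 g hg μ hμ a hρ μW Ψ₀ f μA 2))⟩ : P.space.toSubmodule) ∈
        F.toSubmodule := by
      show _ ∈ S.topologicalClosure.comap P.space.toSubmodule.subtype
      rw [Submodule.mem_comap]
      exact S.le_topologicalClosure (Submodule.subset_span ⟨Ψ₀, rfl⟩)
    rw [hF] at hmem
    have h0 := (ContRepresentation.ClosedSubrep.mem_bot (π := P.space.toContRep)).1 hmem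
    exact congrArg Subtype.val h0
  · intro v hv
    have hmem : (⟨v, hv⟩ : P.space.toSubmodule) ∈ F.toSubmodule := by
      rw [hF]; exact ContRepresentation.ClosedSubrep.mem_top (π := P.space.toContRep) _
    exact (Submodule.mem_comap.1 hmem)

/-- **CYCLICITY OF THE PROJECTED THETA CLASSES**: if `pr_P [Θ̃_{Ψ₀}(f) ∘ ιA] ≠ 0` for ONE Schwartz–Bruhat `Ψ₀`, then for every non-zero
`v ∈ P` there is a PURE TENSOR `E(φ ⊗ Φ_f)` with `⟪v, pr_P [Θ̃_{E(φ ⊗ Φ_f)}(f) ∘ ιA]⟫ ≠ 0` — otherwise `v` is orthogonal to every projected class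
(pure tensors are total, ★ `exists_tmul_apply_toLp_lineThetaLift_ne_zero`), hence to their closed span, which contains `v`.
[cite: BorelJacquet1979, §4.6] [cite: Tate1967, §3.2] [cite: Liu2021, proof of Prop. 4.13 Case 1 (l. 2137–2141, p. 48)] -/
theorem exists_tmul_inner_starProjection_toLp_lineThetaLift_ne_zero (Ψ₀ : piSchwartzBruhat (↥(maximalRealSubfield L)) (Fin n'))
    (hΨ₀ : P.space.toSubmodule.starProjection
      (MemLp.toLp _ (memLp_toQuotFun_lineThetaLift L N H e₁ dV hdV hdV0 g hg μ hμ a hρ μW Ψ₀ f μA 2)) ≠ 0)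
    {v : (adelicGroupData (↥(maximalRealSubfield L)) L (IsCMField.complexConj L) N H).L2 μA} (hv : v ∈ P.space.toSubmodule) (hv0 : v ≠ 0) :
    ∃ (φ : 𝓢((Fin n' → mixedEmbedding.mixedSpace ↥(maximalRealSubfield L)), ℂ)) (Φf : FinSB (↥(maximalRealSubfield L)) (Fin n')),
      ⟪v, P.space.toSubmodule.starProjection
        (MemLp.toLp _ (memLp_toQuotFun_lineThetaLift L N H e₁ dV hdV hdV0 g hg μ hμ a hρ μW
          (piSchwartzBruhatEquiv (↥(maximalRealSubfield L)) (Fin n') (φ ⊗ₜ[ℂ] Φf)) f μA 2))⟫_ℂ ≠ 0 := by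
  -- the functional `x ↦ ⟪v, pr_P x⟫`
  obtain ⟨Sv, hSv⟩ : ∃ Sv : (adelicGroupData (↥(maximalRealSubfield L)) L (IsCMField.complexConj L) N H).L2 μA →ₗ[ℂ] ℂ,
      ∀ x, Sv x = ⟪v, P.space.toSubmodule.starProjection x⟫_ℂ :=
    ⟨(innerSL ℂ v).toLinearMap.comp P.space.toSubmodule.starProjection.toLinearMap, fun x => rfl⟩
  -- it does not vanish on every class: else `v ⊥` the closed span `⊇ P ∋ v`
  by_contra hcon
  push Not at hcon
  have hall : ∀ Ψ : piSchwartzBruhat (↥(maximalRealSubfield L)) (Fin n'),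
      Sv (MemLp.toLp _ (memLp_toQuotFun_lineThetaLift L N H e₁ dV hdV hdV0 g hg μ hμ a hρ μW Ψ f μA 2)) = 0 := by
    intro Ψ
    by_contra hΨ
    obtain ⟨φ, Φf, hne⟩ := exists_tmul_apply_toLp_lineThetaLift_ne_zero L N H e₁ dV hdV hdV0 g hg μ hμ a hρ μW f μA Sv Ψ hΨ
    exact hne (by rw [hSv]; exact hcon φ Φf)
  -- `S ≤ (ℂ ∙ v)ᗮ`, hence its closure too
  have hle : (Submodule.span ℂ (Set.range fun Ψ : piSchwartzBruhat (↥(maximalRealSubfield L)) (Fin n') =>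
      P.space.toSubmodule.starProjection
        (MemLp.toLp _ (memLp_toQuotFun_lineThetaLift L N H e₁ dV hdV hdV0 g hg μ hμ a hρ μW Ψ f μA 2)))).topologicalClosure ≤
      (ℂ ∙ v)ᗮ := by
    refine Submodule.topologicalClosure_minimal _ ?_ (Submodule.isClosed_orthogonal _)
    rw [Submodule.span_le]
    rintro _ ⟨Ψ, rfl⟩
    rw [SetLike.mem_coe, Submodule.mem_orthogonal_singleton_iff_inner_right]
    exact (hSv _).symm.trans (hall Ψ)
  have hvmem := hle (le_topologicalClosure_span_starProjection_toLp_lineThetaLift L H e₁ dV hdV hdV0 g hg μ hμ a hρ μW f P Ψ₀ hΨ₀ hv)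
  rw [Submodule.mem_orthogonal_singleton_iff_inner_right] at hvmem
  exact hv0 (inner_self_eq_zero.1 hvmem)

end Equivariance

/-! ## §3 The `K_∞`-type of the cotangent classes: `R(σ(k₀)) [Φ_j] = Σ_i (Jac k₀ x₀)_{ij} • [Φ_i]` -/

section KType

variable (L : Type) [Field L] [NumberField L] [IsCMField L] (ι : L →+* ℂ) (H : Matrix (Fin 3) (Fin 3) L) (T : GL (Fin 3) ℂ)
  (hT : (T : Matrix (Fin 3) (Fin 3) ℂ)ᴴ * H.map ι * (T : Matrix (Fin 3) (Fin 3) ℂ) = BallModel.J)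
  {μA : Measure (adelicGroupData (↥(maximalRealSubfield L)) L (IsCMField.complexConj L) 3 H).automorphicQuotient}
  [SMulInvariantMeasure (adelicGroupData (↥(maximalRealSubfield L)) L (IsCMField.complexConj L) 3 H).Adelic
    (adelicGroupData (↥(maximalRealSubfield L)) L (IsCMField.complexConj L) 3 H).automorphicQuotient μA]
  {Φh : (adelicGroupData (↥(maximalRealSubfield L)) L (IsCMField.complexConj L) 3 H).Adelic → (Fin 2 → ℂ)}
  (hΦh : Φh ∈ holCotForms (↥(maximalRealSubfield L)) L (IsCMField.complexConj L) 3 H (cmArchSection L ι H T hT)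
    (cmCompactFactor L ι H T hT))
  (hm : ∀ j : Fin 2, MemLp (toQuotFun (adelicGroupData (↥(maximalRealSubfield L)) L (IsCMField.complexConj L) 3 H) fun x => Φh x j) 2 μA)

include hΦh in
/-- **The right translate of a holomorphic cotangent form by `σ(k₀)`, `k₀ ∈ Stab(x₀)`, is `(Jac k₀ x₀)ᵀ Φ`**: `Φ(x σ(k₀)) = (Jac k₀ x₀)ᵀ *ᵥ Φ(x)`
(★ `WeightForms.right_equiv` for the cotangent isotropy representation `weightOf x₀ : k ↦ (Jac k⁻¹ x₀)ᵀ`, so `τ(k₀⁻¹) = (Jac k₀ x₀)ᵀ`, ★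
`cotangentCocycle_apply`). [cite: Borel1997, §5.14] [cite: BorelWallach2000, VI 4.7] -/
theorem apply_mul_cmArchSection_of_mem_stabilizer (k : stabilizer U21 x₀)
    (x : (adelicGroupData (↥(maximalRealSubfield L)) L (IsCMField.complexConj L) 3 H).Adelic) :
    Φh (x * cmArchSection L ι H T hT k) = (Jac (k : U21) x₀)ᵀ *ᵥ Φh x := by
  obtain ⟨hw, -, -, -⟩ := mem_holCotForms_iff.mp hΦh
  have key := WeightForms.right_equiv hw k x
  have hι : ((cmArchSection L ι H T hT).comp (stabilizer U21 x₀).subtype) k = cmArchSection L ι H T hT k := rfl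
  rw [hι] at key
  rw [key, IsPullbackCocycle.weightOf_inv_apply, BallForms.cotangentCocycle_apply]

include hΦh in
/-- coordinate form of `apply_mul_cmArchSection_of_mem_stabilizer`: `Φ_j(x σ(k₀)) = Σ_i (Jac k₀ x₀)_{ij} Φ_i(x)`. [cite: Borel1997, §5.14] -/
theorem apply_mul_cmArchSection_of_mem_stabilizer_coord (k : stabilizer U21 x₀)
    (x : (adelicGroupData (↥(maximalRealSubfield L)) L (IsCMField.complexConj L) 3 H).Adelic) (j : Fin 2) :
    Φh (x * cmArchSection L ι H T hT k) j = ∑ i : Fin 2, Jac (k : U21) x₀ i j * Φh x i := by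
  rw [apply_mul_cmArchSection_of_mem_stabilizer L ι H T hT hΦh k x, Matrix.mulVec, dotProduct]
  rfl

include hΦh in
/-- **THE `K_∞`-TYPE OF THE COTANGENT CLASSES**: for `k₀ ∈ Stab_{U(2,1)}(x₀)` and a holomorphic cotangent form `Φ` with square-integrable
coordinate classes `[Φ_0], [Φ_1]`, `R(σ(k₀)) [Φ_j] = Σ_i (Jac k₀ x₀)_{ij} • [Φ_i]` in `L²([U(H)])` — the span of the two classes is the `K_∞`-module
`k₀ = diag(A, d) ↦ Jac k₀ x₀ = d⁻¹ A` (★ `U21KTypes.pPlus`; `R(z)[F]([x]) = [F]([z⁻¹x])`, `[x] ↦ Φ_j(x⁻¹ σ(k₀))` by ★ `toQuotFun_mk`).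
[cite: Borel1997, §5.14] [cite: BorelWallach2000, VI 4.7] [cite: BorelJacquet1979, §4.6] -/
theorem rightRegular_cmArchSection_toLp_toQuotFun (k : stabilizer U21 x₀) (j : Fin 2) :
    (adelicGroupData (↥(maximalRealSubfield L)) L (IsCMField.complexConj L) 3 H).rightRegular μA (cmArchSection L ι H T hT k)
        ((hm j).toLp _) =
      ∑ i : Fin 2, Jac (k : U21) x₀ i j • (hm i).toLp _ := by
  have hleft := fun i => left_inv_of_mem_holCotForms L ι H T hT hΦh i
  -- the right side is the class of `x ↦ Σ_i Jac_{ij} Φ_i`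
  have hsum : ∑ i : Fin 2, Jac (k : U21) x₀ i j • (hm i).toLp _ =
      (MemLp.toLp _ ((((hm 0).const_smul (Jac (k : U21) x₀ 0 j)).add ((hm 1).const_smul (Jac (k : U21) x₀ 1 j))))) := by
    rw [Fin.sum_univ_two, MemLp.toLp_add ((hm 0).const_smul _) ((hm 1).const_smul _), MemLp.toLp_const_smul,
      MemLp.toLp_const_smul]
  rw [hsum, AdelicGroupData.rightRegular_apply, DomMulAct.mk_smul_toLp]
  refine MemLp.toLp_congr _ _ (Filter.Eventually.of_forall fun q => ?_)
  obtain ⟨w, rfl⟩ := QuotientGroup.mk_surjective q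
  show toQuotFun (adelicGroupData (↥(maximalRealSubfield L)) L (IsCMField.complexConj L) 3 H) (fun x => Φh x j)
      ((adelicGroupData (↥(maximalRealSubfield L)) L (IsCMField.complexConj L) 3 H).toAutomorphicQuotient
        ((cmArchSection L ι H T hT k)⁻¹ * w)) = _
  simp only [Pi.add_apply, Pi.smul_apply, smul_eq_mul]
  erw [toQuotFun_mk (hleft j), toQuotFun_mk (hleft 0), toQuotFun_mk (hleft 1)]
  rw [mul_inv_rev, inv_inv, apply_mul_cmArchSection_of_mem_stabilizer_coord L ι H T hT hΦh k w⁻¹ j, Fin.sum_univ_two]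

include hΦh in
/-- **TRANSLATED FORM**: for `h ∈ U(2,1)` the classes `w_j := R(σ(h)) [Φ_j]` satisfy `R(σ(h k₀ h⁻¹)) w_j = Σ_i (Jac k₀ x₀)_{ij} • w_i` for every
`k₀ ∈ Stab(x₀)` — the same `K_∞`-module transported to `Stab(h x₀) = h Stab(x₀) h⁻¹` (used with `h x₀ = x₁`, the point of the ball fixed by the
frame's block-compact subgroup, ★ `isPretransitive_U21_ball`). [cite: Borel1997, §5.14] [cite: Holzapfel1998, §4.1] -/
theorem rightRegular_conj_cmArchSection_toLp_toQuotFun (h : U21) (k : stabilizer U21 x₀) (j : Fin 2) :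
    (adelicGroupData (↥(maximalRealSubfield L)) L (IsCMField.complexConj L) 3 H).rightRegular μA (cmArchSection L ι H T hT (h * k * h⁻¹))
        ((adelicGroupData (↥(maximalRealSubfield L)) L (IsCMField.complexConj L) 3 H).rightRegular μA (cmArchSection L ι H T hT h)
          ((hm j).toLp _)) =
      ∑ i : Fin 2, Jac (k : U21) x₀ i j •
        (adelicGroupData (↥(maximalRealSubfield L)) L (IsCMField.complexConj L) 3 H).rightRegular μA (cmArchSection L ι H T hT h)
          ((hm i).toLp _) := by
  have hmul : ∀ (x y : (adelicGroupData (↥(maximalRealSubfield L)) L (IsCMField.complexConj L) 3 H).Adelic)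
      (z : (adelicGroupData (↥(maximalRealSubfield L)) L (IsCMField.complexConj L) 3 H).L2 μA),
      (adelicGroupData (↥(maximalRealSubfield L)) L (IsCMField.complexConj L) 3 H).rightRegular μA x
          ((adelicGroupData (↥(maximalRealSubfield L)) L (IsCMField.complexConj L) 3 H).rightRegular μA y z) =
        (adelicGroupData (↥(maximalRealSubfield L)) L (IsCMField.complexConj L) 3 H).rightRegular μA (x * y) z := fun x y z => by
    rw [map_mul]; rfl
  rw [hmul, ← map_mul, show h * (k : U21) * h⁻¹ * h = h * k by group, map_mul, ← hmul,
    rightRegular_cmArchSection_toLp_toQuotFun L ι H T hT hΦh hm k j, map_sum]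
  simp only [map_smul]

end KType

end Literature.NumberTheory.Automorphic.Liu2021

end
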